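import Summits.ABC.IUTFork.Conditional.AbcOfSHvolMixAdditive
import Summits.ABC.ABC.Theorems.IUTThetaPilotThetaPartIIULineSzpiroBad
import HarnessLib

/-!
# Branch C — the CONE-FREE TAIL as a theorem of its own: `ABC` (and the crux `ThetaPartII`) from [IUTchIII] Cor. 3.12 at the
# Szpiro-bad admissible points (`h312Bad`) and [IUTchIV] Thm. 1.10 Step (viii)'s squeeze ON the mixing locus (`hSqMix`) — CONE 0

C scoreboard (R2 S-chain team, abc-iut-s2-p10 gen 8 — K downstream statement-line lineage p447155 / p449259 / p455513; claim
«STATEMENT-MIX»). PROOF-ONLY file: no `def`, no new `Prop`, no instance, no notation; every hypothesis text is copied VERBATIM from the landed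
theorem it is fed to, every proof is a composition BY NAME. TAKES NO SIDE on [IUTchIII] Cor. 3.12 / [IUTchIV] Thm. 1.10 or on any author.

WHAT IS NEW. abc-iut-C-cert-2's cone-free stable companion of record `Conditional.abc_of_SH_orNum_K_szpiroBad_mix` (p457468 ✓, C-R40 (1))
and its M twin `abc_of_SH_orNum_M_szpiroBad_mix` (p457739) each prove INLINE the same junction: at an admissible SZPIRO-BAD `(P, l)`
(antecedent of abc-iut-c312-d1's `Cor22.forall_cor312Of_of_szpiroBad`), [IUTchIII] Cor. 3.12 in reading (U) at the Θ-volume data of the point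
(`Cor22.Cor312AtDatum P l`) gives the squeeze `((l+1)/24 − 1/(2l))·log q^{∤{2,l}}(λ) ≤ B_III(P,l) + ((l+5)/4)·log π` consumed by the route's
tail (abc-iut-S-d2 `ThetaPartIIDisplay.ThetaPartII_of_squeezeIII`) OFF abc-iut-s2-p1's kernel-stated MIXING LOCUS — by the PROVED hull estimate
`Conditional.hvol_offMixingLocus_holds` (p455026 ✓) and abc-iut-S2's `PointDict.logQAvoid_le_of_cor312AtDatum` — while ON the locus the squeeze
is the NUMBER-level hypothesis `hSqMix` ([IUTchIV] Thm. 1.10 Step (viii) display p. 30 at the point; C-R38 (1): NUM-class); at Szpiro-good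
points the squeeze is content-free (abc-iut-s2-p2 `ThetaPartII.squeeze_of_szpiroGood`). This file states that junction ONCE, as theorems
over the two hypothesis FAMILIES `h312Bad` (abc-iut-s2-p2's binder of `ThetaPartII.ABC_of_cor312Bad_of_hullRegimeBad`, p452755, VERBATIM) and
`hSqMix` (p457468's binder VERBATIM), so that every statement-line / licence-line certificate with a `h312Bad`-shaped brick gets its
cone-free twin in ONE line (companion file `AbcOfStatementGenuineMix`: the K and M downstream statement lines):

* §1 `squeeze_of_cor312At_offMixingLocus` — at ONE admissible `(P, l)` OFF the mixing locus: `Cor22.Cor312AtDatum P l` ALONE gives the full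
  squeeze (binder-free; the `∃ M` form of abc-iut-s2-p1's `squeeze_of_cor312At_of_pointSlotConstant`, which is its `M = ∅` case).
* §2 **`ThetaPartII_of_cor312Bad_of_sqMix`** / **`ABC_of_cor312Bad_of_sqMix`** — the crux `ThetaPartII` (stmt-ABC-19678) and `ABC` from
  `h312Bad` · `hSqMix`: explicit 2, **CONE 0** (no `hvol` / `hreg` / `hregBad` / `hres` / `hSz` / `hMix` text anywhere in the signature).
* §3 `sqMix_of_cor312Bad_of_hullRegimeBad` — COMPARISON, in kernel: under `h312Bad`, the α-tail's CONE binder `hregBad` IMPLIES `hSqMix`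
  (abc-iut-s2-p2 `ThetaPartII.squeeze_of_cor312At_of_hullRegimeAt`); so `ABC_of_cor312Bad_of_sqMix` is the STRONGER theorem and
  `ThetaPartII.ABC_of_cor312Bad_of_hullRegimeBad h312Bad hregBad = ABC_of_cor312Bad_of_sqMix h312Bad (sqMix_of_cor312Bad_of_hullRegimeBad h312Bad hregBad)`
  up to proof irrelevance.

HONEST STRENGTH (numbers, not adjectives): `hSqMix` is an assumption label for [IUTchIV] Thm. 1.10's conclusion at exactly the admissible
Szpiro-bad points with a mixed prime inside the mixing locus (by abc-iut-s2-p1's floor 2026-08-26T16:41:46Z such points have natural-log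
height ≥ 3.3·10⁸; none is known); it is neither proved nor refuted in the tree; `h312Bad` is the disputed Corollary in reading (U) at the
Θ-volume data of Szpiro-bad points. «`ABC` follows from these two hypothesis families AS TYPED», nothing more. HONEST FRAMING: locates /
conditionally verifies; nothing here asserts that abc is proved or refuted, or that [IUTchIII] Cor. 3.12 / [IUTchIV] Thm. 1.10 holds or fails at
any datum, or takes a side on any author (Mochizuki / Scholze–Stix / Joshi / Dupuy–Hilado); typed ≠ proved; instantiated ≠ endorsed;
refuted-as-typed ≠ refuted-in-print. [claim: Mochizuki2012, status: disputed] [cite: Mochizuki2012, IUTchIII Cor. 3.12 p. 173–174; IUTchIV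
Thm. 1.10 p. 22–31 (Step (viii) display p. 30 l. 30–53), Cor. 2.2 (ii)–(iii) p. 43–47, Cor. 2.3 p. 54–55] [cite: DupuyHilado2025, §3.3, §3.6, §4.7]
-/

noncomputable section

open Set Function NumberField IsDedekindDomain

namespace Summit.ABC.IUTFork.Conditional

open Literature.IUT.LogVolume Literature.IUT.HodgeTheaters Literature.NumberTheory.NumberFields
open Literature.NumberTheory.DiophantineGeometry.GenEll Summit.ABC.ABC.Theorems
open scoped Classical

/-! ## §1. One admissible point OFF the mixing locus: the squeeze from Cor. 3.12 at the point ALONE -/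

/-- **The full squeeze at ONE admissible `(λ, l)` OFF abc-iut-s2-p1's mixing locus, from [IUTchIII] Cor. 3.12 at the point ALONE.** For
`λ ∈ U_P` (minimal), prime `l ≥ 5`, «admits an `F`-core», (P2), (P5), (P6): IF `Cor22.Cor312AtDatum P l` (HYPOTHESIS — the disputed Corollary
in reading (U) at the Θ-volume data of the point) and SOME finite `M ⊇` the mixed primes of `λ` satisfies p455026's off-locus inequality
`((l+1)/24)·H_mix(M) ≤ (l+1)/4·{(4(d_mod−1)/l)·(lD+lC) + (20/3)·log(d*l)·max(0, π(d*l) − (2d_mod(lD+lC)+log(30l))/log 2)}` (text VERBATIM),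
THEN `((l+1)/24 − 1/(2l))·log q^{∤{2,l}}(λ) ≤ B_III(P,l) + ((l+5)/4)·log π` — NO hull binder: the hull estimate is abc-iut-s2-p1's THEOREM
`Conditional.hvol_offMixingLocus_holds`, a datum is abc-iut-L5-t7's `ThetaPartII.stub_thetaData`, the squeeze is abc-iut-S2's
`PointDict.logQAvoid_le_of_cor312AtDatum`. (`M = ∅` admissible ⇒ abc-iut-s2-p1's `squeeze_of_cor312At_of_pointSlotConstant`.) CONDITIONAL on
Cor. 3.12 at the point only; nothing asserted about it; no side taken. [cite: Mochizuki2012, IUTchIV Thm. 1.10 Step (viii) p. 30]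
[cite: Mochizuki2012, IUTchIII Cor. 3.12 p. 174] [claim: Mochizuki2012, status: disputed] -/
theorem squeeze_of_cor312At_offMixingLocus {P : NFPoint} (hP : P ∈ UP) {l : ℕ} (hl : l.Prime) (h5 : 5 ≤ l)
    (hcore : Cor22.AdmitsCore P) (hP2 : Cor22.CondP2 P l) (hP5 : Cor22.CondP5 P l) (h6 : Cor22.CondP6 P l)
    (h312 : Cor22.Cor312AtDatum P l)
    (hOff : ∃ M : Finset ℕ,
        (∀ p : ℕ, p.Prime →
          (¬ ∀ V W : HeightOneSpectrum (𝓞 ↥(IntermediateField.adjoin ℚ ({Cor22.jInv P.x} : Set P.F))),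
            V ∈ placesOver _ p → W ∈ placesOver _ p →
            (if ord _ V (Cor22.jMod P) < 0 ∧ ((2 : ℕ) : 𝓞 _) ∉ V.asIdeal ∧ ((l : ℕ) : 𝓞 _) ∉ V.asIdeal
              then ((-ord _ V (Cor22.jMod P) : ℤ) : ℝ) * logNorm _ V / (localDegree _ V : ℝ) else 0) =
            (if ord _ W (Cor22.jMod P) < 0 ∧ ((2 : ℕ) : 𝓞 _) ∉ W.asIdeal ∧ ((l : ℕ) : 𝓞 _) ∉ W.asIdeal
              then ((-ord _ W (Cor22.jMod P) : ℤ) : ℝ) * logNorm _ W / (localDegree _ W : ℝ) else 0)) → p ∈ M) ∧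
        ((l : ℝ) + 1) / 24 *
            ∑ p ∈ M, ∑ V : placesOver ↥(IntermediateField.adjoin ℚ ({Cor22.jInv P.x} : Set P.F)) p,
              (if ord _ V.1 (Cor22.jMod P) < 0 ∧ ((2 : ℕ) : 𝓞 _) ∉ V.1.asIdeal ∧ ((l : ℕ) : 𝓞 _) ∉ V.1.asIdeal then
                weight _ V.1 * (((-ord _ V.1 (Cor22.jMod P) : ℤ) : ℝ) * logNorm _ V.1 / (localDegree _ V.1 : ℝ))
               else 0) ≤
          ((l : ℝ) + 1) / 4 * (4 * ((Cor22.dmod P : ℝ) - 1) / l * (P.logDiff + Cor22.logCondAvoid P {2, l})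
            + 20 / 3 * Real.log (((2 ^ 12 * 3 ^ 3 * 5 * Cor22.dmod P : ℕ) : ℝ) * l)
              * max 0 (((Nat.primeCounting (2 ^ 12 * 3 ^ 3 * 5 * Cor22.dmod P * l) : ℝ)
                - (2 * (Cor22.dmod P : ℝ) * (P.logDiff + Cor22.logCondAvoid P {2, l}) + Real.log (2 * 3 * 5 * (l : ℝ)))
                  / Real.log 2))))
    : (((l : ℝ) + 1) / 24 - 1 / (2 * l)) * Cor22.logQAvoid P {2, l} ≤
        ((l : ℝ) + 1) / 4 *
          ((1 + 12 * (Cor22.dmod P : ℝ) / l) * (P.logDiff + Cor22.logCondAvoid P {2, l})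
            + 2 * Real.log l + 52
            + 20 / 3 * Real.log (((2 ^ 12 * 3 ^ 3 * 5 * Cor22.dmod P : ℕ) : ℝ) * (l : ℝ))
              * (Nat.primeCounting (2 ^ 12 * 3 ^ 3 * 5 * Cor22.dmod P * l) : ℝ))
        + ThetaVolumeInput.archLogTheta l := by
  obtain ⟨T⟩ := ThetaPartII.stub_thetaData P hP l hl h5 hcore hP2 hP5 h6
  exact PointDict.logQAvoid_le_of_cor312AtDatum h312 (hvol_offMixingLocus_holds P hP l hl h5 hcore hP2 hP5 h6 hOff) T hP.1

/-! ## §2. The crux `ThetaPartII` and `ABC` from `h312Bad` · `hSqMix` — CONE 0 -/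

/-- **The crux `ThetaPartII` (stmt-ABC-19678) from [IUTchIII] Cor. 3.12 at the SZPIRO-BAD admissible points (`h312Bad`, reading (U), at the
Θ-volume data) and [IUTchIV] Thm. 1.10 Step (viii)'s squeeze ON the mixing locus at those points (`hSqMix`, p457468's binder VERBATIM) — NO
hypothesis about any hull.** Per admissible `(P, l)`: Szpiro-GOOD ⇒ abc-iut-s2-p2's content-free `ThetaPartII.squeeze_of_szpiroGood`; Szpiro-BAD
and OFF the mixing locus ⇒ §1 (`h312Bad` at the point + abc-iut-s2-p1's theorem p455026); Szpiro-BAD and ON the locus ⇒ `hSqMix`; then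
abc-iut-S-d2's `ThetaPartIIDisplay.ThetaPartII_of_squeezeIII`. Explicit 2 = [C312-U, Szpiro-bad] · [NUM-1.10, Szpiro-bad ∧ mixing]; CONE 0.
CONDITIONAL; does not close the item; nothing asserted about either hypothesis family; no side taken on [IUTchIII] Cor. 3.12 / [IUTchIV]
Thm. 1.10; typed ≠ proved. [cite: Mochizuki2012, IUTchIV Thm. 1.10 Step (viii) p. 30; Cor. 2.2 (ii) p. 41–48] [claim: Mochizuki2012, status: disputed] -/
theorem ThetaPartII_of_cor312Bad_of_sqMix
    (h312Bad : ∀ P : NFPoint, P ∈ UP → ∀ l : ℕ, l.Prime → 5 ≤ l →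
      Cor22.AdmitsCore P → Cor22.CondP2 P l → Cor22.CondP5 P l → Cor22.CondP6 P l →
      (((l : ℝ) + 5) / 4 < (Cor22.dmod P : ℝ) ∨
        6 * l * (((l : ℝ) + 5) - 4 * Cor22.dmod P) / (((l : ℝ) + 4) * ((l : ℝ) - 3))
            * (P.logDiff + (1 - 1 / (l : ℝ)) * Cor22.logCondAvoid P {2, l})
          + 6 * l * ((l : ℝ) + 5) / (((l : ℝ) + 4) * ((l : ℝ) - 3)) * Real.log Real.pi < Cor22.logQAvoid P {2, l}) →
        Cor22.Cor312AtDatum P l)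
    -- [NUM-1.10, Szpiro-bad ∧ mixing] [IUTchIV] Thm 1.10 Step (viii)'s squeeze at the admissible SZPIRO-BAD points IN the mixing locus
    -- (abc-iut-C-cert-2's binder of `abc_of_SH_orNum_K_szpiroBad_mix`, p457468, VERBATIM)
    (hSqMix : ∀ P : NFPoint, P ∈ UP → ∀ l : ℕ, l.Prime → 5 ≤ l →
      Cor22.AdmitsCore P → Cor22.CondP2 P l → Cor22.CondP5 P l → Cor22.CondP6 P l →
      (((l : ℝ) + 5) / 4 < (Cor22.dmod P : ℝ) ∨
        6 * l * (((l : ℝ) + 5) - 4 * Cor22.dmod P) / (((l : ℝ) + 4) * ((l : ℝ) - 3))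
            * (P.logDiff + (1 - 1 / (l : ℝ)) * Cor22.logCondAvoid P {2, l})
          + 6 * l * ((l : ℝ) + 5) / (((l : ℝ) + 4) * ((l : ℝ) - 3)) * Real.log Real.pi < Cor22.logQAvoid P {2, l}) →
      ¬ (∃ M : Finset ℕ,
        (∀ p : ℕ, p.Prime →
          (¬ ∀ V W : HeightOneSpectrum (𝓞 ↥(IntermediateField.adjoin ℚ ({Cor22.jInv P.x} : Set P.F))),
            V ∈ placesOver _ p → W ∈ placesOver _ p →
            (if ord _ V (Cor22.jMod P) < 0 ∧ ((2 : ℕ) : 𝓞 _) ∉ V.asIdeal ∧ ((l : ℕ) : 𝓞 _) ∉ V.asIdeal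
              then ((-ord _ V (Cor22.jMod P) : ℤ) : ℝ) * logNorm _ V / (localDegree _ V : ℝ) else 0) =
            (if ord _ W (Cor22.jMod P) < 0 ∧ ((2 : ℕ) : 𝓞 _) ∉ W.asIdeal ∧ ((l : ℕ) : 𝓞 _) ∉ W.asIdeal
              then ((-ord _ W (Cor22.jMod P) : ℤ) : ℝ) * logNorm _ W / (localDegree _ W : ℝ) else 0)) → p ∈ M) ∧
        ((l : ℝ) + 1) / 24 *
            ∑ p ∈ M, ∑ V : placesOver ↥(IntermediateField.adjoin ℚ ({Cor22.jInv P.x} : Set P.F)) p,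
              (if ord _ V.1 (Cor22.jMod P) < 0 ∧ ((2 : ℕ) : 𝓞 _) ∉ V.1.asIdeal ∧ ((l : ℕ) : 𝓞 _) ∉ V.1.asIdeal then
                weight _ V.1 * (((-ord _ V.1 (Cor22.jMod P) : ℤ) : ℝ) * logNorm _ V.1 / (localDegree _ V.1 : ℝ))
               else 0) ≤
          ((l : ℝ) + 1) / 4 * (4 * ((Cor22.dmod P : ℝ) - 1) / l * (P.logDiff + Cor22.logCondAvoid P {2, l})
            + 20 / 3 * Real.log (((2 ^ 12 * 3 ^ 3 * 5 * Cor22.dmod P : ℕ) : ℝ) * l)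
              * max 0 (((Nat.primeCounting (2 ^ 12 * 3 ^ 3 * 5 * Cor22.dmod P * l) : ℝ)
                - (2 * (Cor22.dmod P : ℝ) * (P.logDiff + Cor22.logCondAvoid P {2, l}) + Real.log (2 * 3 * 5 * (l : ℝ)))
                  / Real.log 2)))) →
      (((l : ℝ) + 1) / 24 - 1 / (2 * l)) * Cor22.logQAvoid P {2, l} ≤
        ((l : ℝ) + 1) / 4 *
          ((1 + 12 * (Cor22.dmod P : ℝ) / l) * (P.logDiff + Cor22.logCondAvoid P {2, l})
            + 2 * Real.log l + 52
            + 20 / 3 * Real.log (((2 ^ 12 * 3 ^ 3 * 5 * Cor22.dmod P : ℕ) : ℝ) * (l : ℝ))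
              * (Nat.primeCounting (2 ^ 12 * 3 ^ 3 * 5 * Cor22.dmod P * l) : ℝ))
        + ThetaVolumeInput.archLogTheta l)
    : Summit.ABC.ABC.Theses.IUTThetaPilot.ThetaPartII := by
  refine ThetaPartIIDisplay.ThetaPartII_of_squeezeIII fun P hP l hl h5 hc h2 h5' h6 => ?_
  -- the squeeze at a SZPIRO-BAD point: OFF the mixing locus by §1 (p455026 + Cor. 3.12 at the point), ON it by `hSqMix`
  have key : (((l : ℝ) + 5) / 4 < (Cor22.dmod P : ℝ) ∨
        6 * l * (((l : ℝ) + 5) - 4 * Cor22.dmod P) / (((l : ℝ) + 4) * ((l : ℝ) - 3))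
            * (P.logDiff + (1 - 1 / (l : ℝ)) * Cor22.logCondAvoid P {2, l})
          + 6 * l * ((l : ℝ) + 5) / (((l : ℝ) + 4) * ((l : ℝ) - 3)) * Real.log Real.pi < Cor22.logQAvoid P {2, l}) →
      (((l : ℝ) + 1) / 24 - 1 / (2 * l)) * Cor22.logQAvoid P {2, l} ≤
        ((l : ℝ) + 1) / 4 *
          ((1 + 12 * (Cor22.dmod P : ℝ) / l) * (P.logDiff + Cor22.logCondAvoid P {2, l})
            + 2 * Real.log l + 52
            + 20 / 3 * Real.log (((2 ^ 12 * 3 ^ 3 * 5 * Cor22.dmod P : ℕ) : ℝ) * (l : ℝ))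
              * (Nat.primeCounting (2 ^ 12 * 3 ^ 3 * 5 * Cor22.dmod P * l) : ℝ))
        + ThetaVolumeInput.archLogTheta l := by
    intro hbad
    by_cases hOff : (∃ M : Finset ℕ,
        (∀ p : ℕ, p.Prime →
          (¬ ∀ V W : HeightOneSpectrum (𝓞 ↥(IntermediateField.adjoin ℚ ({Cor22.jInv P.x} : Set P.F))),
            V ∈ placesOver _ p → W ∈ placesOver _ p →
            (if ord _ V (Cor22.jMod P) < 0 ∧ ((2 : ℕ) : 𝓞 _) ∉ V.asIdeal ∧ ((l : ℕ) : 𝓞 _) ∉ V.asIdeal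
              then ((-ord _ V (Cor22.jMod P) : ℤ) : ℝ) * logNorm _ V / (localDegree _ V : ℝ) else 0) =
            (if ord _ W (Cor22.jMod P) < 0 ∧ ((2 : ℕ) : 𝓞 _) ∉ W.asIdeal ∧ ((l : ℕ) : 𝓞 _) ∉ W.asIdeal
              then ((-ord _ W (Cor22.jMod P) : ℤ) : ℝ) * logNorm _ W / (localDegree _ W : ℝ) else 0)) → p ∈ M) ∧
        ((l : ℝ) + 1) / 24 *
            ∑ p ∈ M, ∑ V : placesOver ↥(IntermediateField.adjoin ℚ ({Cor22.jInv P.x} : Set P.F)) p,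
              (if ord _ V.1 (Cor22.jMod P) < 0 ∧ ((2 : ℕ) : 𝓞 _) ∉ V.1.asIdeal ∧ ((l : ℕ) : 𝓞 _) ∉ V.1.asIdeal then
                weight _ V.1 * (((-ord _ V.1 (Cor22.jMod P) : ℤ) : ℝ) * logNorm _ V.1 / (localDegree _ V.1 : ℝ))
               else 0) ≤
          ((l : ℝ) + 1) / 4 * (4 * ((Cor22.dmod P : ℝ) - 1) / l * (P.logDiff + Cor22.logCondAvoid P {2, l})
            + 20 / 3 * Real.log (((2 ^ 12 * 3 ^ 3 * 5 * Cor22.dmod P : ℕ) : ℝ) * l)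
              * max 0 (((Nat.primeCounting (2 ^ 12 * 3 ^ 3 * 5 * Cor22.dmod P * l) : ℝ)
                - (2 * (Cor22.dmod P : ℝ) * (P.logDiff + Cor22.logCondAvoid P {2, l}) + Real.log (2 * 3 * 5 * (l : ℝ)))
                  / Real.log 2))))
    · exact squeeze_of_cor312At_offMixingLocus hP hl h5 hc h2 h5' h6 (h312Bad P hP l hl h5 hc h2 h5' h6 hbad) hOff
    · exact hSqMix P hP l hl h5 hc h2 h5' h6 hbad hOff
  by_cases hd : (Cor22.dmod P : ℝ) ≤ ((l : ℝ) + 5) / 4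
  · by_cases hq : Cor22.logQAvoid P {2, l} ≤
        6 * l * (((l : ℝ) + 5) - 4 * Cor22.dmod P) / (((l : ℝ) + 4) * ((l : ℝ) - 3))
            * (P.logDiff + (1 - 1 / (l : ℝ)) * Cor22.logCondAvoid P {2, l})
          + 6 * l * ((l : ℝ) + 5) / (((l : ℝ) + 4) * ((l : ℝ) - 3)) * Real.log Real.pi
    · -- SZPIRO-GOOD: content-free (abc-iut-s2-p2) — NOTHING assumed
      exact ThetaPartII.squeeze_of_szpiroGood h5 hd hq
    · exact key (Or.inr (lt_of_not_ge hq))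
  · exact key (Or.inl (lt_of_not_ge hd))

/-- **`ABC` from [IUTchIII] Cor. 3.12 at the SZPIRO-BAD admissible points (`h312Bad`) and [IUTchIV] Thm. 1.10 Step (viii)'s squeeze ON the
mixing locus there (`hSqMix`) — explicit 2, CONE 0** — through the route's deciding theorem `closes`, abc-iut-S6's `genEllTwo_holds` and the
proved `JInvWlog_proof`. The cone-free TAIL of abc-iut-C-cert-2's stable companion of record p457468 / p457739 as a theorem over the two
hypothesis families; every certificate with a `h312Bad`-shaped brick gets its cone-free twin by ONE application. CONDITIONAL; nothing asserted
about the two hypotheses; no side taken on [IUTchIII] Cor. 3.12 / [IUTchIV] Thm. 1.10 or on the (U)/(P) reading; typed ≠ proved; instantiated ≠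
endorsed. [cite: Mochizuki2012, IUTchIV Thm. 1.10 Step (viii) p. 30; Cor. 2.2–2.3 p. 41–55] [cite: Mochizuki2012, IUTchIII Cor. 3.12 p. 174]
[claim: Mochizuki2012, status: disputed] -/
theorem ABC_of_cor312Bad_of_sqMix
    (h312Bad : ∀ P : NFPoint, P ∈ UP → ∀ l : ℕ, l.Prime → 5 ≤ l →
      Cor22.AdmitsCore P → Cor22.CondP2 P l → Cor22.CondP5 P l → Cor22.CondP6 P l →
      (((l : ℝ) + 5) / 4 < (Cor22.dmod P : ℝ) ∨
        6 * l * (((l : ℝ) + 5) - 4 * Cor22.dmod P) / (((l : ℝ) + 4) * ((l : ℝ) - 3))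
            * (P.logDiff + (1 - 1 / (l : ℝ)) * Cor22.logCondAvoid P {2, l})
          + 6 * l * ((l : ℝ) + 5) / (((l : ℝ) + 4) * ((l : ℝ) - 3)) * Real.log Real.pi < Cor22.logQAvoid P {2, l}) →
        Cor22.Cor312AtDatum P l)
    -- [NUM-1.10, Szpiro-bad ∧ mixing] (p457468's binder VERBATIM)
    (hSqMix : ∀ P : NFPoint, P ∈ UP → ∀ l : ℕ, l.Prime → 5 ≤ l →
      Cor22.AdmitsCore P → Cor22.CondP2 P l → Cor22.CondP5 P l → Cor22.CondP6 P l →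
      (((l : ℝ) + 5) / 4 < (Cor22.dmod P : ℝ) ∨
        6 * l * (((l : ℝ) + 5) - 4 * Cor22.dmod P) / (((l : ℝ) + 4) * ((l : ℝ) - 3))
            * (P.logDiff + (1 - 1 / (l : ℝ)) * Cor22.logCondAvoid P {2, l})
          + 6 * l * ((l : ℝ) + 5) / (((l : ℝ) + 4) * ((l : ℝ) - 3)) * Real.log Real.pi < Cor22.logQAvoid P {2, l}) →
      ¬ (∃ M : Finset ℕ,
        (∀ p : ℕ, p.Prime →
          (¬ ∀ V W : HeightOneSpectrum (𝓞 ↥(IntermediateField.adjoin ℚ ({Cor22.jInv P.x} : Set P.F))),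
            V ∈ placesOver _ p → W ∈ placesOver _ p →
            (if ord _ V (Cor22.jMod P) < 0 ∧ ((2 : ℕ) : 𝓞 _) ∉ V.asIdeal ∧ ((l : ℕ) : 𝓞 _) ∉ V.asIdeal
              then ((-ord _ V (Cor22.jMod P) : ℤ) : ℝ) * logNorm _ V / (localDegree _ V : ℝ) else 0) =
            (if ord _ W (Cor22.jMod P) < 0 ∧ ((2 : ℕ) : 𝓞 _) ∉ W.asIdeal ∧ ((l : ℕ) : 𝓞 _) ∉ W.asIdeal
              then ((-ord _ W (Cor22.jMod P) : ℤ) : ℝ) * logNorm _ W / (localDegree _ W : ℝ) else 0)) → p ∈ M) ∧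
        ((l : ℝ) + 1) / 24 *
            ∑ p ∈ M, ∑ V : placesOver ↥(IntermediateField.adjoin ℚ ({Cor22.jInv P.x} : Set P.F)) p,
              (if ord _ V.1 (Cor22.jMod P) < 0 ∧ ((2 : ℕ) : 𝓞 _) ∉ V.1.asIdeal ∧ ((l : ℕ) : 𝓞 _) ∉ V.1.asIdeal then
                weight _ V.1 * (((-ord _ V.1 (Cor22.jMod P) : ℤ) : ℝ) * logNorm _ V.1 / (localDegree _ V.1 : ℝ))
               else 0) ≤
          ((l : ℝ) + 1) / 4 * (4 * ((Cor22.dmod P : ℝ) - 1) / l * (P.logDiff + Cor22.logCondAvoid P {2, l})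
            + 20 / 3 * Real.log (((2 ^ 12 * 3 ^ 3 * 5 * Cor22.dmod P : ℕ) : ℝ) * l)
              * max 0 (((Nat.primeCounting (2 ^ 12 * 3 ^ 3 * 5 * Cor22.dmod P * l) : ℝ)
                - (2 * (Cor22.dmod P : ℝ) * (P.logDiff + Cor22.logCondAvoid P {2, l}) + Real.log (2 * 3 * 5 * (l : ℝ)))
                  / Real.log 2)))) →
      (((l : ℝ) + 1) / 24 - 1 / (2 * l)) * Cor22.logQAvoid P {2, l} ≤
        ((l : ℝ) + 1) / 4 *
          ((1 + 12 * (Cor22.dmod P : ℝ) / l) * (P.logDiff + Cor22.logCondAvoid P {2, l})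
            + 2 * Real.log l + 52
            + 20 / 3 * Real.log (((2 ^ 12 * 3 ^ 3 * 5 * Cor22.dmod P : ℕ) : ℝ) * (l : ℝ))
              * (Nat.primeCounting (2 ^ 12 * 3 ^ 3 * 5 * Cor22.dmod P * l) : ℝ))
        + ThetaVolumeInput.archLogTheta l)
    : _root_.ABC :=
  Summit.ABC.ABC.Theses.IUTThetaPilot.closes (ThetaPartII_of_cor312Bad_of_sqMix h312Bad hSqMix) genEllTwo_holds JInvWlog_proof

/-! ## §3. Comparison with the α-tail: `hregBad ⟹ hSqMix` under `h312Bad` (the mix certificates are the STRONGER theorems) -/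

/-- **COMPARISON, in kernel: under `h312Bad`, the α-tail's CONE binder `hregBad` (abc-iut-s2-p2's binder of
`ThetaPartII.ABC_of_cor312Bad_of_hullRegimeBad`, p452755, VERBATIM) IMPLIES `hSqMix`** (indeed the squeeze at EVERY Szpiro-bad admissible point,
mixing or not): abc-iut-s2-p2's `ThetaPartII.squeeze_of_cor312At_of_hullRegimeAt` (slot-constant data by abc-iut-S3's pinned estimate over
`stub_R4`, a datum by `stub_thetaData`, the squeeze by abc-iut-S2). Hence `ABC_of_cor312Bad_of_sqMix` has WEAKER hypotheses than the α-tail, and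
every `… _hregBad` certificate of the C scoreboard follows from its `… _mix` twin by this lemma. Nothing asserted about `h312Bad`, `hregBad` or
`hSqMix` (the unrestricted ancestor `hreg` of `hregBad` is refuted AS TYPED, `Conditional.not_hreg_v4`; refuted-as-typed ≠ refuted-in-print);
no side taken. [cite: Mochizuki2012, IUTchIV Thm. 1.10 Steps (ii)–(viii) p. 24–30] [claim: Mochizuki2012, status: disputed] -/
theorem sqMix_of_cor312Bad_of_hullRegimeBad
    (h312Bad : ∀ P : NFPoint, P ∈ UP → ∀ l : ℕ, l.Prime → 5 ≤ l →
      Cor22.AdmitsCore P → Cor22.CondP2 P l → Cor22.CondP5 P l → Cor22.CondP6 P l →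
      (((l : ℝ) + 5) / 4 < (Cor22.dmod P : ℝ) ∨
        6 * l * (((l : ℝ) + 5) - 4 * Cor22.dmod P) / (((l : ℝ) + 4) * ((l : ℝ) - 3))
            * (P.logDiff + (1 - 1 / (l : ℝ)) * Cor22.logCondAvoid P {2, l})
          + 6 * l * ((l : ℝ) + 5) / (((l : ℝ) + 4) * ((l : ℝ) - 3)) * Real.log Real.pi < Cor22.logQAvoid P {2, l}) →
        Cor22.Cor312AtDatum P l)
    -- [CONE, Szpiro-bad] `hregBad` (abc-iut-s2-p2's binder VERBATIM)
    (hregBad : ∀ P : NFPoint, P ∈ UP → ∀ l : ℕ, l.Prime → 5 ≤ l →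
      Cor22.AdmitsCore P → Cor22.CondP2 P l → Cor22.CondP5 P l → Cor22.CondP6 P l →
      (((l : ℝ) + 5) / 4 < (Cor22.dmod P : ℝ) ∨
        6 * l * (((l : ℝ) + 5) - 4 * Cor22.dmod P) / (((l : ℝ) + 4) * ((l : ℝ) - 3))
            * (P.logDiff + (1 - 1 / (l : ℝ)) * Cor22.logCondAvoid P {2, l})
          + 6 * l * ((l : ℝ) + 5) / (((l : ℝ) + 4) * ((l : ℝ) - 3)) * Real.log Real.pi < Cor22.logQAvoid P {2, l}) →
      ∀ T : Cor22.ThetaVolumeDatumAt P l,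
        (letI := T.instFieldF; letI := T.instNumberFieldF; letI := T.instAlgebraF; letI := T.instFieldK
         letI := T.instNumberFieldK; letI := T.instAlgebraK; letI := T.instFieldFbar; letI := T.instAlgebraFbar
         letI := T.instAlgebraKFbar; letI := T.instIsElliptic
         ¬ (∀ p ∈ T.I.supportPrimes, ∀ v w : placesOver (fieldOfModuli T.E) p,
            (Summit.ABC.IUTFork.DHData.ofInput T.I).logQloc p v = (Summit.ABC.IUTFork.DHData.ofInput T.I).logQloc p w)) →
        T.HullEstimateOf
          (((l : ℝ) + 1) / 4 *
            ((1 + 12 * (Cor22.dmod P : ℝ) / l) * (P.logDiff + Cor22.logCondAvoid P {2, l})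
              + 2 * Real.log l + 52
              + 20 / 3 * Real.log (((2 ^ 12 * 3 ^ 3 * 5 * Cor22.dmod P : ℕ) : ℝ) * (l : ℝ))
                * (Nat.primeCounting (2 ^ 12 * 3 ^ 3 * 5 * Cor22.dmod P * l) : ℝ))))
    : ∀ P : NFPoint, P ∈ UP → ∀ l : ℕ, l.Prime → 5 ≤ l →
      Cor22.AdmitsCore P → Cor22.CondP2 P l → Cor22.CondP5 P l → Cor22.CondP6 P l →
      (((l : ℝ) + 5) / 4 < (Cor22.dmod P : ℝ) ∨
        6 * l * (((l : ℝ) + 5) - 4 * Cor22.dmod P) / (((l : ℝ) + 4) * ((l : ℝ) - 3))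
            * (P.logDiff + (1 - 1 / (l : ℝ)) * Cor22.logCondAvoid P {2, l})
          + 6 * l * ((l : ℝ) + 5) / (((l : ℝ) + 4) * ((l : ℝ) - 3)) * Real.log Real.pi < Cor22.logQAvoid P {2, l}) →
      ¬ (∃ M : Finset ℕ,
        (∀ p : ℕ, p.Prime →
          (¬ ∀ V W : HeightOneSpectrum (𝓞 ↥(IntermediateField.adjoin ℚ ({Cor22.jInv P.x} : Set P.F))),
            V ∈ placesOver _ p → W ∈ placesOver _ p →
            (if ord _ V (Cor22.jMod P) < 0 ∧ ((2 : ℕ) : 𝓞 _) ∉ V.asIdeal ∧ ((l : ℕ) : 𝓞 _) ∉ V.asIdeal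
              then ((-ord _ V (Cor22.jMod P) : ℤ) : ℝ) * logNorm _ V / (localDegree _ V : ℝ) else 0) =
            (if ord _ W (Cor22.jMod P) < 0 ∧ ((2 : ℕ) : 𝓞 _) ∉ W.asIdeal ∧ ((l : ℕ) : 𝓞 _) ∉ W.asIdeal
              then ((-ord _ W (Cor22.jMod P) : ℤ) : ℝ) * logNorm _ W / (localDegree _ W : ℝ) else 0)) → p ∈ M) ∧
        ((l : ℝ) + 1) / 24 *
            ∑ p ∈ M, ∑ V : placesOver ↥(IntermediateField.adjoin ℚ ({Cor22.jInv P.x} : Set P.F)) p,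
              (if ord _ V.1 (Cor22.jMod P) < 0 ∧ ((2 : ℕ) : 𝓞 _) ∉ V.1.asIdeal ∧ ((l : ℕ) : 𝓞 _) ∉ V.1.asIdeal then
                weight _ V.1 * (((-ord _ V.1 (Cor22.jMod P) : ℤ) : ℝ) * logNorm _ V.1 / (localDegree _ V.1 : ℝ))
               else 0) ≤
          ((l : ℝ) + 1) / 4 * (4 * ((Cor22.dmod P : ℝ) - 1) / l * (P.logDiff + Cor22.logCondAvoid P {2, l})
            + 20 / 3 * Real.log (((2 ^ 12 * 3 ^ 3 * 5 * Cor22.dmod P : ℕ) : ℝ) * l)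
              * max 0 (((Nat.primeCounting (2 ^ 12 * 3 ^ 3 * 5 * Cor22.dmod P * l) : ℝ)
                - (2 * (Cor22.dmod P : ℝ) * (P.logDiff + Cor22.logCondAvoid P {2, l}) + Real.log (2 * 3 * 5 * (l : ℝ)))
                  / Real.log 2)))) →
      (((l : ℝ) + 1) / 24 - 1 / (2 * l)) * Cor22.logQAvoid P {2, l} ≤
        ((l : ℝ) + 1) / 4 *
          ((1 + 12 * (Cor22.dmod P : ℝ) / l) * (P.logDiff + Cor22.logCondAvoid P {2, l})
            + 2 * Real.log l + 52
            + 20 / 3 * Real.log (((2 ^ 12 * 3 ^ 3 * 5 * Cor22.dmod P : ℕ) : ℝ) * (l : ℝ))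
              * (Nat.primeCounting (2 ^ 12 * 3 ^ 3 * 5 * Cor22.dmod P * l) : ℝ))
        + ThetaVolumeInput.archLogTheta l :=
  fun P hP l hl h5 hc h2 h5' h6 hbad _ =>
    ThetaPartII.squeeze_of_cor312At_of_hullRegimeAt hP hl h5 hc h2 h5' h6 (h312Bad P hP l hl h5 hc h2 h5' h6 hbad)
      (hregBad P hP l hl h5 hc h2 h5' h6 hbad)

end Summit.ABC.IUTFork.Conditional

end
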